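import Literature.NumberTheory.Sieve.HeathBrownCubicSieveSetup
import Literature.NumberTheory.LFunctions.IdealCountProofs
import Literature.NumberTheory.LFunctions.IdealNormCount
import Literature.NumberTheory.Sieve.DivisorPowerSums
import HarnessLib

/-!
# Heath-Brown's Lemma 3.3 (the Type I bound for `ℬ^(K)`) — proof

Pure-proof companion of `HeathBrownCubicSieveSetup` (fourth layer of the decomposition of
**parity.S18** along Heath-Brown, *Primes represented by `x³ + 2y³`*, Acta Math. 186 (2001)). That
file vendors the two Type I inputs of the sieve as named facts; here the second one,
`HeathBrown2001_typeI_B` (**Lemma 3.3**, level of distribution `X^{3−ε}` for `ℬ^(K)`), is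
DISCHARGED: `HeathBrown2001_typeI_B_holds`.

The printed proof (p. 32: "The proof of Lemma 3.3 is, by contrast, almost trivial") runs:
`#ℬ^(K)_R = #{I : N(I) ∈ (3X³/N(R), 3X³(1+η)/N(R)]}`; by **Lemma 4.1** (Weber, p. 22:
`#{I : N(I) ≤ x} = γ₀x + O(x^{2/3})`) this is (5.7) `#ℬ^(K)_R = 3γ₀ηX³N(R)^{-1} + O(X²N(R)^{-2/3})`;
summing, the sum in Lemma 3.3 is `≪ X² ∑_{Q<N(R)≤2Q} τ(R)^A N(R)^{-2/3} ≪ X²Q^{1/3}(log Q)^{c(A)}` by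
**Lemma 4.2** (p. 22: `∑_{N(I)≤x} τ(I)^A ≪ x(log x)^{c(A)}`, reduced to the rational-integer bound
`∑_{n≤x} τ(n)^A ≪ x(log x)^{c(A)}` via "there are at most `τ(n)²` ideals `I` with `N(I) = n`, and
`τ(I) ≤ τ(n)³` for each"). Everything in this file is PROVED:

* `idealNormCount_le_sigma_zero_pow_three` — `c_K(n) ≤ τ(n)³` (`c_K(n) = #{I : N(I) = n}`; the tree's
  `c_K(p^e) ≤ (e+1)^{[K:ℚ]}` and multiplicativity, `Literature.NumberTheory.LFunctions.IdealNormCount`;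
  Heath-Brown's sharper `τ(n)²` is not needed);
  `idealDivisorCount_le_sigma_zero_pow_four` — `τ(R) ≤ τ(N(R))⁴` (every divisor of `R` has norm
  dividing `N(R)`);
* **Lemma 4.2 over `K`** (`exists_sum_idealDivisorCount_pow_le`):
  `∑_{0<N(R)≤N} τ(R)^A ≤ C_A N (log N)^{2^{4A+4}}` for `N ≥ 2`, from the tree's
  `∑_{n≤N} τ(n)^r ≤ C_r N(log N)^{2^{r+1}}` (`Literature.NumberTheory.Sieve.exists_sum_sigma_zero_pow_le`)
  with `r = 4A + 3`;
* `countB_eq_idealCount_sub` — `#ℬ^(K)_R = I_K(3X³(1+η)/N(R)) − I_K(3X³/N(R))` for `R ≠ 0`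
  (`I_K(x) = #{J ≠ 0 : N(J) ≤ x}`, `Literature.NumberTheory.LFunctions.NumberField.idealCount`; the members
  of `ℬ^(K)_R` are `R·J'`, unique factorisation);
* **(5.7)** (`exists_abs_countB_sub_le`): `|#ℬ^(K)_R − 3γ₀ηX³/N(R)| ≤ C X²/N(R)^{2/3}` for all
  `R ≠ 0`, `X ≥ 0`, `0 ≤ η ≤ 1`, from the Weber–Landau count with error term PROVED in the tree for
  every number field (`Literature.NumberTheory.LFunctions.NumberField.idealCount_sub_residue_mul_le_holds`,
  exponent `1 − 1/[K:ℚ] = 2/3`), extended to `0 ≤ x < 1` where `I_K(x) = 0`;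
* **Lemma 3.3** (`HeathBrown2001_typeI_B_holds`), with `c(A) = 2^{4A+4}`.

## References

* D. R. Heath-Brown, *Primes represented by `x³ + 2y³`*, Acta Math. 186 (2001), 1–84: Lemma 3.3
  (p. 11), its proof and (5.7) (p. 32), Lemmas 4.1, 4.2 (p. 22). [cite: HeathBrownActa2001, Lemma 3.3]

## Mathlib / tree search

Tree: `HeathBrownCubicSieveSetup` (`countB`, `BIdeals`, `normWindow`, `idealsLE`,
`idealDivisorCount`, `gamma₀`, the fact), `LFunctions.NumberField.idealCount`,
`idealCount_eq_idealCount_floor`, `idealCount_natCast_eq_sum`, `idealCount_sub_residue_mul_le_holds`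
(`IdealCountProofs`), `LFunctions.idealNormCount`, `idealNormCount_mul_of_coprime`,
`IdealNormCount.idealNormCount_prime_pow_le_nat` (`IdealNormCount`), `Sieve.exists_sum_sigma_zero_pow_le`,
`Sieve.sigma_zero_le_of_dvd` (`DivisorPowerSums`), `CubeRootTwoField.finrank_K`. (The general
`c_K(n) ≤ τ(n)^{[K:ℚ]}` is `Literature.NumberTheory.LFunctions.idealNormCount_le_card_divisors_pow` in
`RHGeneralizedRHDedekindProofs`; the cubic case is re-derived here in ten lines to keep this layer's
imports free of the Selberg-class files.) Mathlib: `Nat.recOnPosPrimePosCoprime`,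
`ArithmeticFunction.sigma_zero_apply_prime_pow`, `ArithmeticFunction.isMultiplicative_sigma`,
`Finset.sum_fiberwise_of_maps_to'`, `Finset.card_biUnion_le`, `Ideal.absNorm_ne_zero_iff_mem_nonZeroDivisors`,
`Equiv.subtypeSubtypeEquivSubtypeInter`, `mul_right_injective₀`, `Real.rpow_sub`,
`Real.rpow_le_rpow_of_exponent_ge`.
-/

noncomputable section

open NumberField Finset

open scoped ArithmeticFunction.sigma nonZeroDivisors

namespace Literature.NumberTheory.Sieve.CubicSieve

open LFunctions.CubeRootTwoField CubicPrimes

/-! ### Ideals of a given norm and the bound `τ(R) ≤ τ(N(R))⁴` -/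

/-- The members of a finite set of ideals with norm `d` number `c_K(d)`, provided the set contains
every ideal of norm `d`. [folklore] -/
theorem card_filter_absNorm_eq {S : Finset (Ideal (𝓞 K))} {d : ℕ}
    (hS : ∀ D : Ideal (𝓞 K), Ideal.absNorm D = d → D ∈ S) :
    #{D ∈ S | Ideal.absNorm D = d} = LFunctions.idealNormCount K d := by
  rw [LFunctions.idealNormCount_def, ← Nat.card_eq_finsetCard]
  refine Nat.card_congr (Equiv.subtypeEquivRight fun D => ?_)
  rw [mem_filter]
  exact ⟨fun h => h.2, fun h => ⟨hS D h, h⟩⟩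

/-- **`c_K(n) ≤ τ(n)³`** for `n ≥ 1` and `K = ℚ(2^{1/3})`: both sides are multiplicative and
`c_K(p^e) ≤ (e+1)^{[K:ℚ]} = τ(p^e)³` (an ideal of norm `p^e` is determined by the exponents `≤ e` of
the `≤ 3` primes above `p`). Heath-Brown records the sharper "at most `τ(n)²` ideals `I` with
`N(I) = n`" (p. 22); the cube suffices. [cite: HeathBrownActa2001, Lemma 4.2] -/
theorem idealNormCount_le_sigma_zero_pow_three {n : ℕ} (hn : n ≠ 0) :
    LFunctions.idealNormCount K n ≤ σ 0 n ^ 3 := by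
  induction n using Nat.recOnPosPrimePosCoprime with
  | zero => exact (hn rfl).elim
  | one => simp [LFunctions.idealNormCount_one, ArithmeticFunction.sigma_one]
  | prime_pow p e hp he =>
    rw [ArithmeticFunction.sigma_zero_apply_prime_pow hp]
    have h := LFunctions.IdealNormCount.idealNormCount_prime_pow_le_nat K hp e
    rwa [finrank_K] at h
  | coprime a b ha hb hab iha ihb =>
    rw [LFunctions.idealNormCount_mul_of_coprime K hab,
      ArithmeticFunction.isMultiplicative_sigma.map_mul_of_coprime hab, mul_pow]
    exact Nat.mul_le_mul (iha (by omega)) (ihb (by omega))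

open scoped Classical in
/-- `τ(R) ≤ ∑_{d ∣ N(R)} c_K(d)` for `R ≠ 0`: a divisor of `R` has norm dividing `N(R)`. [folklore] -/
theorem idealDivisorCount_le_sum_divisors {R : Ideal (𝓞 K)} (hR : R ≠ ⊥) :
    idealDivisorCount R ≤ ∑ d ∈ (Ideal.absNorm R).divisors, LFunctions.idealNormCount K d := by
  set n := Ideal.absNorm R with hn
  have hn0 : n ≠ 0 := by rw [hn, Ne, Ideal.absNorm_eq_zero_iff]; exact hR
  calc idealDivisorCount R = #{D ∈ idealsLE n | D ∣ R} := rfl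
    _ ≤ #(n.divisors.biUnion fun d => {D ∈ idealsLE n | Ideal.absNorm D = d}) := by
        refine card_le_card fun D hD => ?_
        rw [mem_filter] at hD
        obtain ⟨hle, hdvd⟩ := hD
        rw [mem_biUnion]
        exact ⟨Ideal.absNorm D, Nat.mem_divisors.mpr
          ⟨Ideal.absNorm_dvd_absNorm_of_le (Ideal.le_of_dvd hdvd), hn0⟩, mem_filter.mpr ⟨hle, rfl⟩⟩
    _ ≤ ∑ d ∈ n.divisors, #{D ∈ idealsLE n | Ideal.absNorm D = d} := card_biUnion_le
    _ = ∑ d ∈ n.divisors, LFunctions.idealNormCount K d :=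
        sum_congr rfl fun d hd => card_filter_absNorm_eq fun D hD =>
          mem_idealsLE.mpr (hD ▸ Nat.divisor_le hd)

/-- **`τ(R) ≤ τ(N(R))⁴`** for `R ≠ 0` (`τ(R) ≤ ∑_{d ∣ n} c_K(d) ≤ τ(n)·τ(n)³`, `n = N(R)`; Heath-Brown:
"`τ(I) ≤ τ(n)³` for each" `I` of norm `n`, p. 22). [cite: HeathBrownActa2001, Lemma 4.2] -/
theorem idealDivisorCount_le_sigma_zero_pow_four {R : Ideal (𝓞 K)} (hR : R ≠ ⊥) :
    idealDivisorCount R ≤ σ 0 (Ideal.absNorm R) ^ 4 := by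
  set n := Ideal.absNorm R with hn
  have hn0 : n ≠ 0 := by rw [hn, Ne, Ideal.absNorm_eq_zero_iff]; exact hR
  calc idealDivisorCount R ≤ ∑ d ∈ n.divisors, LFunctions.idealNormCount K d :=
        idealDivisorCount_le_sum_divisors hR
    _ ≤ ∑ d ∈ n.divisors, σ 0 n ^ 3 := sum_le_sum fun d hd =>
        (idealNormCount_le_sigma_zero_pow_three (Nat.pos_of_mem_divisors hd).ne').trans
          (Nat.pow_le_pow_left (sigma_zero_le_of_dvd hn0 (Nat.dvd_of_mem_divisors hd)) 3)
    _ = σ 0 n ^ 4 := by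
        rw [sum_const, smul_eq_mul, ← ArithmeticFunction.sigma_zero_apply]; ring

/-! ### Lemma 4.2 over `K`: `∑_{N(R) ≤ N} τ(R)^A ≪ N (log N)^{c(A)}` -/

open scoped Classical in
/-- **Heath-Brown's Lemma 4.2, second bound, over `K = ℚ(2^{1/3})`**: for every `A ≥ 0` there is
`C = C(A)` with `∑_{0 < N(R) ≤ N} τ(R)^A ≤ C N (log N)^{2^{4A+4}}` for all `N ≥ 2` ("For any integer
`A ≥ 0` there is a constant `c(A)` such that `∑_{N(I) ≤ x} τ(I)^A ≪ x(log x)^{c(A)}`", p. 22; proof as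
printed: group by `n = N(I)`, `c_K(n) τ(I)^A ≤ τ(n)³·τ(n)^{4A}`, and apply the rational bound
`∑_{n ≤ x} τ(n)^{4A+3} ≪ x(log x)^{c}`, here the tree's
`Literature.NumberTheory.Sieve.exists_sum_sigma_zero_pow_le` with `c = 2^{4A+4}`).
[cite: HeathBrownActa2001, Lemma 4.2] -/
theorem exists_sum_idealDivisorCount_pow_le (A : ℕ) :
    ∃ C : ℝ, 0 < C ∧ ∀ N : ℕ, 2 ≤ N →
      ∑ R ∈ (idealsLE N).filter (· ≠ ⊥), (idealDivisorCount R : ℝ) ^ A ≤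
        C * N * Real.log N ^ (2 ^ (4 * A + 4)) := by
  obtain ⟨C, hC, h⟩ := exists_sum_sigma_zero_pow_le (4 * A + 3)
  refine ⟨C, hC, fun N hN => ?_⟩
  set S := (idealsLE N).filter (· ≠ ⊥) with hS
  have hmaps : ∀ R ∈ S, Ideal.absNorm R ∈ Icc 1 N := by
    intro R hR
    rw [hS, mem_filter, mem_idealsLE] at hR
    rw [mem_Icc]
    exact ⟨Nat.pos_of_ne_zero fun h0 => hR.2 (Ideal.absNorm_eq_zero_iff.mp h0), hR.1⟩
  calc ∑ R ∈ S, (idealDivisorCount R : ℝ) ^ A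
      ≤ ∑ R ∈ S, (σ 0 (Ideal.absNorm R) : ℝ) ^ (4 * A) := by
        refine sum_le_sum fun R hR => ?_
        have hR0 : R ≠ ⊥ := (mem_filter.mp hR).2
        have h4 : (idealDivisorCount R : ℝ) ≤ (σ 0 (Ideal.absNorm R) : ℝ) ^ 4 := by
          exact_mod_cast idealDivisorCount_le_sigma_zero_pow_four hR0
        calc (idealDivisorCount R : ℝ) ^ A ≤ ((σ 0 (Ideal.absNorm R) : ℝ) ^ 4) ^ A :=
              pow_le_pow_left₀ (Nat.cast_nonneg _) h4 A
          _ = (σ 0 (Ideal.absNorm R) : ℝ) ^ (4 * A) := by rw [← pow_mul]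
    _ = ∑ n ∈ Icc 1 N, ∑ R ∈ S with Ideal.absNorm R = n, (σ 0 n : ℝ) ^ (4 * A) :=
        (sum_fiberwise_of_maps_to' hmaps fun n : ℕ => (σ 0 n : ℝ) ^ (4 * A)).symm
    _ = ∑ n ∈ Icc 1 N, (LFunctions.idealNormCount K n : ℝ) * (σ 0 n : ℝ) ^ (4 * A) := by
        refine sum_congr rfl fun n hn => ?_
        rw [sum_const, nsmul_eq_mul]
        congr 1
        have h2 : n ≤ N := (mem_Icc.mp hn).2
        have h1 : 1 ≤ n := (mem_Icc.mp hn).1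
        exact_mod_cast card_filter_absNorm_eq (S := S) (d := n) fun D hD => by
          rw [hS, mem_filter, mem_idealsLE]
          refine ⟨hD ▸ h2, fun h0 => ?_⟩
          rw [h0, Ideal.absNorm_bot] at hD
          omega
    _ ≤ ∑ n ∈ Icc 1 N, (σ 0 n : ℝ) ^ (4 * A + 3) := by
        refine sum_le_sum fun n hn => ?_
        have h1 : n ≠ 0 := by have := (mem_Icc.mp hn).1; omega
        have h3 : (LFunctions.idealNormCount K n : ℝ) ≤ (σ 0 n : ℝ) ^ 3 := by
          exact_mod_cast idealNormCount_le_sigma_zero_pow_three h1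
        calc (LFunctions.idealNormCount K n : ℝ) * (σ 0 n : ℝ) ^ (4 * A)
            ≤ (σ 0 n : ℝ) ^ 3 * (σ 0 n : ℝ) ^ (4 * A) :=
              mul_le_mul_of_nonneg_right h3 (by positivity)
          _ = (σ 0 n : ℝ) ^ (4 * A + 3) := by ring
    _ ≤ C * N * Real.log N ^ (2 ^ (4 * A + 3 + 1)) := h N hN
    _ = C * N * Real.log N ^ (2 ^ (4 * A + 4)) := rfl

/-! ### `#ℬ^(K)_R` as a difference of ideal counts, and (5.7) -/

open scoped Classical in
/-- The Weber–Landau counting function `I_K(x) = #{J ≠ 0 : N(J) ≤ x}` (`LFunctions.NumberField.idealCount`)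
as a `Finset` cardinality over `idealsLE ⌊x⌋₊`, for `x ≥ 0`. [folklore] -/
theorem idealCount_eq_card_filter {x : ℝ} (hx : 0 ≤ x) :
    LFunctions.NumberField.idealCount K x = #((idealsLE ⌊x⌋₊).filter (· ≠ ⊥)) := by
  rw [LFunctions.NumberField.idealCount_eq_idealCount_floor K hx, ← Nat.card_eq_finsetCard]
  unfold LFunctions.NumberField.idealCount
  simp_rw [Nat.cast_le]
  refine Nat.card_congr ((Equiv.subtypeSubtypeEquivSubtypeInter
    (fun I : Ideal (𝓞 K) => I ∈ (Ideal (𝓞 K))⁰) (fun I => Ideal.absNorm I ≤ ⌊x⌋₊)).trans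
      (Equiv.subtypeEquivRight fun J => ?_))
  rw [mem_filter, mem_idealsLE, ← Ideal.absNorm_ne_zero_iff_mem_nonZeroDivisors, Ne,
    Ideal.absNorm_eq_zero_iff, and_comm]

/-- `I_K(x) = 0` for `0 ≤ x < 1` (a nonzero ideal has norm `≥ 1`). [folklore] -/
theorem idealCount_eq_zero_of_lt_one {x : ℝ} (hx : 0 ≤ x) (hx1 : x < 1) :
    LFunctions.NumberField.idealCount K x = 0 := by
  rw [LFunctions.NumberField.idealCount_eq_idealCount_floor K hx, Nat.floor_eq_zero.mpr hx1,
    LFunctions.NumberField.idealCount_natCast_eq_sum K 0]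
  simp

open scoped Classical in
/-- **`#ℬ^(K)_R = #{I : N(I) ∈ (3X³/N(R), 3X³(1+η)/N(R)]} = I_K(3X³(1+η)/N(R)) − I_K(3X³/N(R))`** for
`R ≠ 0`, `X ≥ 0`, `η ≥ 0` (p. 32, first display of the proof of Lemma 3.3): the members of `ℬ^(K)_R`
are the ideals `R·I`, and `I ↦ R·I` is injective (unique factorisation of ideals).
[cite: HeathBrownActa2001, §5 (5.7)] -/
theorem countB_eq_idealCount_sub {X η : ℝ} (hX : 0 ≤ X) (hη : 0 ≤ η) {R : Ideal (𝓞 K)}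
    (hR : R ≠ ⊥) :
    (countB X η R : ℝ) =
      LFunctions.NumberField.idealCount K (3 * X ^ 3 * (1 + η) / Ideal.absNorm R) -
        LFunctions.NumberField.idealCount K (3 * X ^ 3 / Ideal.absNorm R) := by
  have hN : 0 < (Ideal.absNorm R : ℝ) := by
    have h0 : Ideal.absNorm R ≠ 0 := fun h => hR (Ideal.absNorm_eq_zero_iff.mp h)
    positivity
  set a : ℝ := 3 * X ^ 3 / Ideal.absNorm R with ha
  set b : ℝ := 3 * X ^ 3 * (1 + η) / Ideal.absNorm R with hb
  have ha0 : 0 ≤ a := by rw [ha]; positivity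
  have hb0 : 0 ≤ b := by rw [hb]; positivity
  -- the window of `I`'s
  set T : Finset (Ideal (𝓞 K)) :=
    (idealsLE ⌊b⌋₊).filter fun I => a < (Ideal.absNorm I : ℝ) ∧ (Ideal.absNorm I : ℝ) ≤ b with hT
  have hmemT : ∀ I : Ideal (𝓞 K), I ∈ T ↔ a < (Ideal.absNorm I : ℝ) ∧ (Ideal.absNorm I : ℝ) ≤ b := by
    intro I
    rw [hT, mem_filter, mem_idealsLE, and_iff_right_iff_imp]
    exact fun h => Nat.le_floor h.2
  -- `ℬ^(K)_R = R · T`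
  have hR0 : (R : Ideal (𝓞 K)) ≠ 0 := by rwa [Ne, Ideal.zero_eq_bot]
  have himage : BIdeals X η R = T.image fun I => R * I := by
    ext J
    rw [mem_BIdeals_iff, mem_normWindow_iff, mem_image]
    constructor
    · rintro ⟨⟨h1, h2⟩, I, rfl⟩
      refine ⟨I, (hmemT I).mpr ?_, rfl⟩
      rw [map_mul, Nat.cast_mul] at h1 h2
      rw [ha, hb, div_lt_iff₀ hN, le_div_iff₀ hN, mul_comm ((Ideal.absNorm I : ℕ) : ℝ)]
      exact ⟨h1, h2⟩
    · rintro ⟨I, hI, rfl⟩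
      rw [hmemT, ha, hb, div_lt_iff₀ hN, le_div_iff₀ hN] at hI
      rw [map_mul, Nat.cast_mul, mul_comm ((Ideal.absNorm R : ℕ) : ℝ)]
      exact ⟨hI, dvd_mul_right R I⟩
  have hcount : countB X η R = #T := by
    rw [countB, himage, card_image_of_injective _ (mul_right_injective₀ hR0)]
  -- `T ⊔ {J ≠ 0 : N(J) ≤ a} = {J ≠ 0 : N(J) ≤ b}`
  have hunion : (idealsLE ⌊b⌋₊).filter (· ≠ ⊥) = T ∪ (idealsLE ⌊a⌋₊).filter (· ≠ ⊥) := by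
    ext J
    rw [mem_union, hmemT, mem_filter, mem_filter, mem_idealsLE, mem_idealsLE,
      Nat.le_floor_iff hb0, Nat.le_floor_iff ha0, Ne, ← Ideal.absNorm_eq_zero_iff]
    constructor
    · rintro ⟨hJb, hJ0⟩
      by_cases hJa : (Ideal.absNorm J : ℝ) ≤ a
      · exact Or.inr ⟨hJa, hJ0⟩
      · exact Or.inl ⟨lt_of_not_ge hJa, hJb⟩
    · rintro (⟨hJa, hJb⟩ | ⟨hJa, hJ0⟩)
      · refine ⟨hJb, fun h0 => ?_⟩
        rw [h0, Nat.cast_zero] at hJa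
        linarith
      · exact ⟨hJa.trans (by rw [ha, hb]; exact div_le_div_of_nonneg_right (by nlinarith [pow_nonneg hX 3]) hN.le), hJ0⟩
  have hdisj : Disjoint T ((idealsLE ⌊a⌋₊).filter (· ≠ ⊥)) := by
    rw [disjoint_left]
    intro J hJT hJa
    rw [hmemT] at hJT
    rw [mem_filter, mem_idealsLE, Nat.le_floor_iff ha0] at hJa
    linarith [hJT.1, hJa.1]
  rw [idealCount_eq_card_filter hb0, idealCount_eq_card_filter ha0, hunion,
    card_union_of_disjoint hdisj, hcount]
  push_cast
  ring

/-- The Weber–Landau count for `K = ℚ(2^{1/3})` on all of `x ≥ 0`: `|I_K(x) − γ₀x| ≤ C x^{2/3}`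
(for `x ≥ 1` this is Lemma 4.1, "The number of integral ideals of `K` with norm at most `x` is
`γ₀x + O(x^{2/3})`", proved in the tree for every number field as
`Literature.NumberTheory.LFunctions.NumberField.idealCount_sub_residue_mul_le_holds` with exponent `1 − 1/[K:ℚ]`; for
`0 ≤ x < 1`, `I_K(x) = 0` and `γ₀x ≤ γ₀x^{2/3}`). [cite: HeathBrownActa2001, Lemma 4.1] -/
theorem exists_abs_idealCount_sub_le :
    ∃ C : ℝ, 0 < C ∧ ∀ x : ℝ, 0 ≤ x →
      |(LFunctions.NumberField.idealCount K x : ℝ) - gamma₀ * x| ≤ C * x ^ (2 / 3 : ℝ) := by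
  obtain ⟨C₀, hC₀⟩ := LFunctions.NumberField.idealCount_sub_residue_mul_le_holds K
  have hexp : (1 : ℝ) - 1 / (Module.finrank ℚ K : ℝ) = 2 / 3 := by rw [finrank_K]; norm_num
  refine ⟨max C₀ 0 + gamma₀, by positivity [gamma₀_pos], fun x hx => ?_⟩
  have hγ := gamma₀_pos
  rcases lt_or_ge x 1 with hx1 | hx1
  · rw [idealCount_eq_zero_of_lt_one hx hx1, Nat.cast_zero, zero_sub, abs_neg,
      abs_of_nonneg (by positivity)]
    have hxle : x ≤ x ^ (2 / 3 : ℝ) := by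
      rcases hx.eq_or_lt with rfl | hx0
      · rw [Real.zero_rpow (by norm_num)]
      · calc x = x ^ (1 : ℝ) := (Real.rpow_one x).symm
          _ ≤ x ^ (2 / 3 : ℝ) := Real.rpow_le_rpow_of_exponent_ge hx0 hx1.le (by norm_num)
    calc gamma₀ * x ≤ gamma₀ * x ^ (2 / 3 : ℝ) := mul_le_mul_of_nonneg_left hxle hγ.le
      _ ≤ (max C₀ 0 + gamma₀) * x ^ (2 / 3 : ℝ) := by
          apply mul_le_mul_of_nonneg_right _ (by positivity)
          linarith [le_max_right C₀ 0]
  · have h := hC₀ x hx1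
    rw [hexp] at h
    calc |(LFunctions.NumberField.idealCount K x : ℝ) - gamma₀ * x| ≤ C₀ * x ^ (2 / 3 : ℝ) := h
      _ ≤ (max C₀ 0 + gamma₀) * x ^ (2 / 3 : ℝ) := by
          apply mul_le_mul_of_nonneg_right _ (by positivity)
          linarith [le_max_left C₀ 0]

/-- **(5.7): `#ℬ^(K)_R = 3γ₀ηX³N(R)^{-1} + O(X²N(R)^{-2/3})`** — explicitly, there is `C > 0` with
`|#ℬ^(K)_R − 3γ₀ηX³/N(R)| ≤ C X²/N(R)^{2/3}` for all `X ≥ 0`, `0 ≤ η ≤ 1` and nonzero `R` (apply the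
Weber–Landau count at `3X³(1+η)/N(R)` and `3X³/N(R)`, both `≤ 6X³/N(R)`).
[cite: HeathBrownActa2001, §5 (5.7)] -/
theorem exists_abs_countB_sub_le :
    ∃ C : ℝ, 0 < C ∧ ∀ X η : ℝ, 0 ≤ X → 0 ≤ η → η ≤ 1 → ∀ R : Ideal (𝓞 K), R ≠ ⊥ →
      |(countB X η R : ℝ) - gamma₀ * (3 * η * X ^ 3) / Ideal.absNorm R| ≤
        C * X ^ 2 / (Ideal.absNorm R : ℝ) ^ (2 / 3 : ℝ) := by
  obtain ⟨C, hC, hW⟩ := exists_abs_idealCount_sub_le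
  refine ⟨2 * C * 6, by positivity, fun X η hX hη0 hη1 R hR => ?_⟩
  have hN : 0 < (Ideal.absNorm R : ℝ) := by
    have h0 : Ideal.absNorm R ≠ 0 := fun h => hR (Ideal.absNorm_eq_zero_iff.mp h)
    positivity
  set N : ℝ := (Ideal.absNorm R : ℝ) with hNdef
  set a : ℝ := 3 * X ^ 3 / N with ha
  set b : ℝ := 3 * X ^ 3 * (1 + η) / N with hb
  have ha0 : 0 ≤ a := by rw [ha]; positivity
  have hb0 : 0 ≤ b := by rw [hb]; positivity
  have hab : a ≤ b := by
    rw [ha, hb]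
    exact div_le_div_of_nonneg_right (by nlinarith [pow_nonneg hX 3]) hN.le
  have hb6 : b ≤ 6 * X ^ 3 / N := by
    rw [hb]
    exact div_le_div_of_nonneg_right (by nlinarith [pow_nonneg hX 3]) hN.le
  -- `b^{2/3} ≤ 6 X² / N^{2/3}`
  have hX32 : (X ^ 3) ^ (2 / 3 : ℝ) = X ^ 2 := by
    rw [← Real.rpow_natCast X 3, ← Real.rpow_mul hX]
    norm_num
  have hbpow : b ^ (2 / 3 : ℝ) ≤ 6 * X ^ 2 / N ^ (2 / 3 : ℝ) := by
    calc b ^ (2 / 3 : ℝ) ≤ (6 * X ^ 3 / N) ^ (2 / 3 : ℝ) :=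
          Real.rpow_le_rpow hb0 hb6 (by norm_num)
      _ = (6 : ℝ) ^ (2 / 3 : ℝ) * X ^ 2 / N ^ (2 / 3 : ℝ) := by
          rw [Real.div_rpow (by positivity) hN.le, Real.mul_rpow (by norm_num) (by positivity), hX32]
      _ ≤ 6 * X ^ 2 / N ^ (2 / 3 : ℝ) := by
          have h6 : (6 : ℝ) ^ (2 / 3 : ℝ) ≤ 6 := by
            calc (6 : ℝ) ^ (2 / 3 : ℝ) ≤ (6 : ℝ) ^ (1 : ℝ) :=
                  Real.rpow_le_rpow_of_exponent_le (by norm_num) (by norm_num)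
              _ = 6 := Real.rpow_one 6
          have hNp : 0 < N ^ (2 / 3 : ℝ) := Real.rpow_pos_of_pos hN _
          exact div_le_div_of_nonneg_right
            (mul_le_mul_of_nonneg_right h6 (pow_nonneg hX 2)) hNp.le
  have key : (countB X η R : ℝ) - gamma₀ * (3 * η * X ^ 3) / N =
      ((LFunctions.NumberField.idealCount K b : ℝ) - gamma₀ * b) -
        ((LFunctions.NumberField.idealCount K a : ℝ) - gamma₀ * a) := by
    rw [countB_eq_idealCount_sub hX hη0 hR, ← ha, ← hb, ha, hb]
    field_simp
    ring
  calc |(countB X η R : ℝ) - gamma₀ * (3 * η * X ^ 3) / N|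
      = |((LFunctions.NumberField.idealCount K b : ℝ) - gamma₀ * b) -
          ((LFunctions.NumberField.idealCount K a : ℝ) - gamma₀ * a)| := by rw [key]
    _ ≤ |(LFunctions.NumberField.idealCount K b : ℝ) - gamma₀ * b| +
          |(LFunctions.NumberField.idealCount K a : ℝ) - gamma₀ * a| := abs_sub _ _
    _ ≤ C * b ^ (2 / 3 : ℝ) + C * a ^ (2 / 3 : ℝ) := add_le_add (hW b hb0) (hW a ha0)
    _ ≤ C * b ^ (2 / 3 : ℝ) + C * b ^ (2 / 3 : ℝ) := by
          gcongr
    _ = 2 * C * b ^ (2 / 3 : ℝ) := by ring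
    _ ≤ 2 * C * (6 * X ^ 2 / N ^ (2 / 3 : ℝ)) := mul_le_mul_of_nonneg_left hbpow (by positivity)
    _ = 2 * C * 6 * X ^ 2 / N ^ (2 / 3 : ℝ) := by ring

/-! ### Lemma 3.3 -/

/-- **Heath-Brown's Lemma 3.3** (the Type I bound for `ℬ^(K)`, level of distribution `X^{3−ε}`),
discharging the named fact `HeathBrown2001_typeI_B`: for every `A ≥ 1` there are `c = 2^{4A+4}` and
`C` with `∑_{Q<N(R)≤2Q} τ(R)^A |#ℬ^(K)_R − 3γ₀ηX³/N(R)| ≤ C X² Q^{1/3} (log Q)^c` for all `X ≥ 2`,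
`η` in the range (2.1) and `Q ≥ 2`. Proof as printed (p. 32): by (5.7) each term is at most
`τ(R)^A · C₅X²N(R)^{-2/3} ≤ τ(R)^A · C₅X²Q^{-2/3}`, and `∑_{N(R) ≤ 2Q} τ(R)^A ≤ C₄·2Q(log 2Q)^c ≤
C₄·2Q(2 log Q)^c` by Lemma 4.2. [cite: HeathBrownActa2001, Lemma 3.3] -/
theorem HeathBrown2001_typeI_B_holds : HeathBrown2001_typeI_B := by
  classical
  intro A hA
  obtain ⟨C₅, hC₅, h57⟩ := exists_abs_countB_sub_le
  obtain ⟨C₄, hC₄, h42⟩ := exists_sum_idealDivisorCount_pow_le A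
  set k : ℕ := 2 ^ (4 * A + 4) with hk
  refine ⟨k, 2 ^ (k + 1) * C₅ * C₄, fun X η Q hX hη0 hη1 hQ => ?_⟩
  have hX0 : 0 ≤ X := by linarith
  have hη0' : 0 ≤ η := (Real.exp_pos _).le.trans hη0
  have hQ0 : 0 < Q := by linarith
  set M : ℕ := ⌊2 * Q⌋₊ with hM
  have hM4 : 4 ≤ M := by
    rw [hM]
    exact Nat.le_floor (by push_cast; linarith)
  have hM2 : 2 ≤ M := le_trans (by norm_num) hM4
  have hMQ : (M : ℝ) ≤ 2 * Q := Nat.floor_le (by positivity)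
  have hM1 : (1 : ℝ) ≤ M := by exact_mod_cast le_trans (by norm_num) hM4
  set F : Finset (Ideal (𝓞 K)) := (idealsLE M).filter fun R =>
    Q < (Ideal.absNorm R : ℝ) ∧ (Ideal.absNorm R : ℝ) ≤ 2 * Q with hF
  -- pointwise: (5.7) and `N(R) > Q`
  have hpt : ∀ R ∈ F, (idealDivisorCount R : ℝ) ^ A *
      |(countB X η R : ℝ) - gamma₀ * (3 * η * X ^ 3) / Ideal.absNorm R| ≤
        (idealDivisorCount R : ℝ) ^ A * (C₅ * X ^ 2 / Q ^ (2 / 3 : ℝ)) := by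
    intro R hR
    rw [hF, mem_filter] at hR
    obtain ⟨-, hQR, -⟩ := hR
    have hR0 : R ≠ ⊥ := by
      intro h0
      rw [h0, Ideal.absNorm_bot, Nat.cast_zero] at hQR
      linarith
    refine mul_le_mul_of_nonneg_left ?_ (by positivity)
    calc |(countB X η R : ℝ) - gamma₀ * (3 * η * X ^ 3) / Ideal.absNorm R|
        ≤ C₅ * X ^ 2 / (Ideal.absNorm R : ℝ) ^ (2 / 3 : ℝ) := h57 X η hX0 hη0' hη1 R hR0
      _ ≤ C₅ * X ^ 2 / Q ^ (2 / 3 : ℝ) :=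
          div_le_div_of_nonneg_left (by positivity) (Real.rpow_pos_of_pos hQ0 _)
            (Real.rpow_le_rpow hQ0.le hQR.le (by norm_num))
  -- Lemma 4.2 over the full range `0 < N(R) ≤ ⌊2Q⌋₊`
  have hsub : F ⊆ (idealsLE M).filter (· ≠ ⊥) := by
    intro R hR
    rw [hF, mem_filter] at hR
    obtain ⟨hRM, hQR, -⟩ := hR
    refine mem_filter.mpr ⟨hRM, fun h0 => ?_⟩
    rw [h0, Ideal.absNorm_bot, Nat.cast_zero] at hQR
    linarith
  have hsum : ∑ R ∈ F, (idealDivisorCount R : ℝ) ^ A ≤ C₄ * M * Real.log M ^ k :=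
    (sum_le_sum_of_subset_of_nonneg hsub fun R _ _ => by positivity).trans (h42 M hM2)
  -- logarithms: `0 ≤ log M ≤ log 2Q ≤ 2 log Q`
  have hlog2 : Real.log 2 ≤ Real.log Q := Real.log_le_log two_pos hQ
  have hlog2pos : 0 < Real.log 2 := Real.log_pos one_lt_two
  have hlogQ : 0 < Real.log Q := hlog2pos.trans_le hlog2
  have hlogM0 : 0 ≤ Real.log M := Real.log_nonneg hM1
  have hlogM : Real.log M ≤ 2 * Real.log Q := by
    calc Real.log M ≤ Real.log (2 * Q) := Real.log_le_log (by positivity) hMQ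
      _ = Real.log 2 + Real.log Q := Real.log_mul two_ne_zero hQ0.ne'
      _ ≤ 2 * Real.log Q := by linarith
  have hQsplit : Q / Q ^ (2 / 3 : ℝ) = Q ^ (1 / 3 : ℝ) := by
    rw [show (1 / 3 : ℝ) = 1 - 2 / 3 by norm_num, Real.rpow_sub hQ0, Real.rpow_one]
  calc ∑ R ∈ F, (idealDivisorCount R : ℝ) ^ A *
        |(countB X η R : ℝ) - gamma₀ * (3 * η * X ^ 3) / Ideal.absNorm R|
      ≤ ∑ R ∈ F, (idealDivisorCount R : ℝ) ^ A * (C₅ * X ^ 2 / Q ^ (2 / 3 : ℝ)) := sum_le_sum hpt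
    _ = (∑ R ∈ F, (idealDivisorCount R : ℝ) ^ A) * (C₅ * X ^ 2 / Q ^ (2 / 3 : ℝ)) := by
        rw [sum_mul]
    _ ≤ C₄ * M * Real.log M ^ k * (C₅ * X ^ 2 / Q ^ (2 / 3 : ℝ)) :=
        mul_le_mul_of_nonneg_right hsum (by positivity)
    _ ≤ C₄ * (2 * Q) * (2 * Real.log Q) ^ k * (C₅ * X ^ 2 / Q ^ (2 / 3 : ℝ)) := by
        gcongr
    _ = 2 ^ (k + 1) * C₅ * C₄ * X ^ 2 * (Q / Q ^ (2 / 3 : ℝ)) * Real.log Q ^ k := by ring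
    _ = 2 ^ (k + 1) * C₅ * C₄ * X ^ 2 * Q ^ (1 / 3 : ℝ) * Real.log Q ^ (k : ℝ) := by
        rw [hQsplit, Real.rpow_natCast]

end Literature.NumberTheory.Sieve.CubicSieve

end
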